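import Mathlib
import HarnessLib
import Summits.NavierStokesRegularity.NavierStokesRegularity.Theorems.PoloidalWindowDoorPoloidalWindowRigidityPoloidalExtremal
import Summits.NavierStokesRegularity.NavierStokesRegularity.Theorems.PoloidalWindowDoorPoloidalWindowRigidityWindow

/-!
# Route `PoloidalWindowDoor`, item `LrcModEntire` (stmt-NavierStokesRegularity-20428) / crux K2 (stmt-19708) —
# the VERTICAL HOT-SPOT normal form («extremal recentring», stub S1 `stub_extremalThread` of the ideator lines
# `far_thread` / `thread_axis`, VERBATIM)

LEAD of item 20428 ns-poloidal-K2-p3 g10 (file `--supports stmt-NavierStokesRegularity-20428 --as helper`).  The THICK column of the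
item (`stub_twistingThick` of skeleton twist_split) has no local mechanism; every class-level attack proposed so far (ideator ns-idea-8's
LINES 4/5 `far_thread` / `thread_axis` on the crux directory) STARTS from the same free normalisation: recentre the profile at the hot spot
of the scale-invariant vertical size `√(−t)|v₂(t,x)|`.  This file proves that normalisation — their shared stub S1 `stub_extremalThread`,
statement verbatim — by the template of `…PoloidalExtremal.exists_poloidal_extremal` (K2 lead, p469616) and
`…EnstrophyHotSpot.exists_enstrophy_hotSpot` (nsreg-p7): near-maximal points of `Q := (−t)·v₂²`, renormalisation by translation and
parabolic rescaling (class and poloidality invariant), KNSS compactness with convergence of gradients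
(`exists_tendsto_of_isTypeIAncientMild_seq`), poloidality of the limit (`poloidal_of_tendsto`).

* `vertSize_nsRescale_translate` — `(−t)·(nsRescale c (v(·, x₀ + ·)) t x)₂² = (−c²t)·v₂(c²t, x₀ + c x)²`;
* `extremalThread` — `stub_extremalThread` VERBATIM: a poloidal class profile with `v₂ ≢ 0` has a poloidal companion in the SAME class with
  `v'₂(−1,0) ≠ 0` and `√(−t)|v'₂(t,x)| ≤ |v'₂(−1,0)|` on the slab.

WHAT THIS IS NOT: not a claim about Navier–Stokes regularity, not the thick stub, not an adoption of LINE 4/5 — a normal form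
(compactness + symmetry, no new mechanism), bears_on LADDER-NS N0, rung N0-LocalTubeDoorPoloidal. [folklore]
-/

noncomputable section

-- the summit and its single sub-problem share the name (CONVENTIONS §1), as in every Theorems file
set_option linter.dupNamespace false

namespace Summit.NavierStokesRegularity.NavierStokesRegularity.Theorems.PoloidalWindowDoorLrcModEntireExtremalThread

open MeasureTheory Set Function Filter Topology
open scoped RealInnerProductSpace InnerProductSpace
open Literature.Analysis Literature.Analysis.FluidPDE
open Summit.NavierStokesRegularity.NavierStokesRegularity.Theorems
open Summit.NavierStokesRegularity.NavierStokesRegularity.Theorems.PoloidalWindowDoorPoloidalWindowRigidityPoloidalExtremal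
open Summit.NavierStokesRegularity.NavierStokesRegularity.Theorems.PoloidalWindowDoorPoloidalWindowRigidityWindow

/-- The scale-invariant vertical size transforms covariantly under the symmetries of the class:
`(−t)·((nsRescale c (v(·, x₀ + ·))) t x)₂² = (−(c²t))·(v (c²t) (x₀ + c•x))₂²`. [folklore] -/
theorem vertSize_nsRescale_translate (c : ℝ) (v : ℝ → EuclideanSpace ℝ (Fin 3) → EuclideanSpace ℝ (Fin 3))
    (x₀ : EuclideanSpace ℝ (Fin 3)) (t : ℝ) (x : EuclideanSpace ℝ (Fin 3)) :
    (-t) * (nsRescale c (fun s y => v s (x₀ + y)) t x 2) ^ 2 =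
      (-(c ^ 2 * t)) * (v (c ^ 2 * t) (x₀ + c • x) 2) ^ 2 := by
  rw [nsRescale_apply]
  simp only [PiLp.smul_apply, smul_eq_mul]
  ring

/-- **VERTICAL HOT-SPOT NORMAL FORM** (= stub S1 `stub_extremalThread` of `Cruxes/PoloidalWindowRigidity/Lines/far_thread.lean` /
`thread_axis.lean`, VERBATIM).  For a profile of the route's Type-I class (rate `C`, joint continuity, Oseen-mild, divergence-free),
poloidal along `e₃`, with `v₂ ≢ 0` on the slab, there is a companion profile in the SAME class (same `C`), poloidal, whose scale-invariant
vertical size `√(−t)|v'₂(t,x)|` attains its supremum over the slab at the hot spot `(−1, 0)`, where `v'₂ ≠ 0`.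
Proof: `Q := (−t)v₂² ≤ C²`; near-maximal points `(t_k, x_k)`; `v_k := nsRescale √(−t_k) (v(·, x_k + ·))` (class and poloidality
invariant); KNSS compactness (fields and gradients converge pointwise); limits preserve the bound and attain the supremum. [folklore] -/
theorem extremalThread :
    ∀ (C : ℝ) (v : ℝ → EuclideanSpace ℝ (Fin 3) → EuclideanSpace ℝ (Fin 3)),
      Literature.Analysis.FluidPDE.HasTypeITimeDecay C v →
      ContinuousOn (Function.uncurry v) (Set.Iio (0 : ℝ) ×ˢ Set.univ) →
      (∀ s t : ℝ, s < t → t < 0 → ∀ x, v t x =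
        Literature.Analysis.UnboundedOperators.heatExtension (v s) (t - s) x -
          Literature.Analysis.FluidPDE.oseenDuhamel 1 s v v t x) →
      (∀ t < 0, Literature.Analysis.FluidPDE.VectorCalculus.IsDivFree (v t)) →
      (∀ s < 0, ∀ y, ⟪Literature.Analysis.FluidPDE.curl (v s) y, EuclideanSpace.single 2 1⟫_ℝ = 0) →
      (∃ t₀ : ℝ, t₀ < 0 ∧ ∃ y₀ : EuclideanSpace ℝ (Fin 3), v t₀ y₀ 2 ≠ 0) →
      ∃ v' : ℝ → EuclideanSpace ℝ (Fin 3) → EuclideanSpace ℝ (Fin 3),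
        Literature.Analysis.FluidPDE.HasTypeITimeDecay C v' ∧
        ContinuousOn (Function.uncurry v') (Set.Iio (0 : ℝ) ×ˢ Set.univ) ∧
        (∀ s t : ℝ, s < t → t < 0 → ∀ x, v' t x =
          Literature.Analysis.UnboundedOperators.heatExtension (v' s) (t - s) x -
            Literature.Analysis.FluidPDE.oseenDuhamel 1 s v' v' t x) ∧
        (∀ t < 0, Literature.Analysis.FluidPDE.VectorCalculus.IsDivFree (v' t)) ∧
        (∀ s < 0, ∀ y, ⟪Literature.Analysis.FluidPDE.curl (v' s) y, EuclideanSpace.single 2 1⟫_ℝ = 0) ∧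
        v' (-1) 0 2 ≠ 0 ∧ (∀ t < 0, ∀ x, Real.sqrt (-t) * |v' t x 2| ≤ |v' (-1) 0 2|) := by
  intro C v hrate hcont hmild hdiv hpol hne
  obtain ⟨s₀, hs₀, y₀, hy₀⟩ := hne
  have hv : IsTypeIAncientMild C v := isTypeIAncientMild_of_class hrate hcont hmild hdiv
  -- the scale-invariant vertical size and its supremum
  set Q : ℝ → EuclideanSpace ℝ (Fin 3) → ℝ := fun t x => (-t) * (v t x 2) ^ 2 with hQdef
  have hQle : ∀ t < 0, ∀ x, Q t x ≤ C ^ 2 := by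
    intro t ht x
    have h1 : ‖v t x‖ ≤ C / Real.sqrt (-t) := hv.norm_le ht x
    have hsq : 0 < Real.sqrt (-t) := Real.sqrt_pos.2 (neg_pos.2 ht)
    have h2 : Real.sqrt (-t) * ‖v t x‖ ≤ C := by
      rw [le_div_iff₀ hsq] at h1; linarith
    have h3 : 0 ≤ Real.sqrt (-t) * ‖v t x‖ := mul_nonneg hsq.le (norm_nonneg _)
    have h4 : |v t x 2| ≤ ‖v t x‖ := by simpa using PiLp.norm_apply_le (v t x) 2
    have h5 : (v t x 2) ^ 2 ≤ ‖v t x‖ ^ 2 := by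
      rw [← sq_abs]; exact pow_le_pow_left₀ (abs_nonneg _) h4 2
    have h6 : (Real.sqrt (-t) * ‖v t x‖) ^ 2 ≤ C ^ 2 := pow_le_pow_left₀ h3 h2 2
    have h7 : Real.sqrt (-t) ^ 2 = -t := Real.sq_sqrt (neg_pos.2 ht).le
    calc Q t x = (-t) * (v t x 2) ^ 2 := rfl
      _ ≤ (-t) * ‖v t x‖ ^ 2 := mul_le_mul_of_nonneg_left h5 (neg_pos.2 ht).le
      _ = (Real.sqrt (-t) * ‖v t x‖) ^ 2 := by rw [mul_pow, h7]
      _ ≤ C ^ 2 := h6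
  set S : Set ℝ := {m | ∃ t < 0, ∃ x, m = Q t x} with hSdef
  have hSbdd : BddAbove S := ⟨C ^ 2, by rintro m ⟨t, ht, x, rfl⟩; exact hQle t ht x⟩
  have hS0 : Q s₀ y₀ ∈ S := ⟨s₀, hs₀, y₀, rfl⟩
  set M : ℝ := sSup S with hMdef
  have hQM : ∀ t < 0, ∀ x, Q t x ≤ M := fun t ht x => le_csSup hSbdd ⟨t, ht, x, rfl⟩
  have hQ0pos : 0 < Q s₀ y₀ := by
    simp only [hQdef]
    exact mul_pos (neg_pos.2 hs₀) (by positivity)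
  have hMpos : 0 < M := hQ0pos.trans_le (hQM s₀ hs₀ y₀)
  -- near-maximal points
  have hpts : ∀ k : ℕ, ∃ t < 0, ∃ x : EuclideanSpace ℝ (Fin 3), M - 1 / ((k : ℝ) + 1) < Q t x := by
    intro k
    have hlt : M - 1 / ((k : ℝ) + 1) < sSup S := by
      have : (0 : ℝ) < 1 / ((k : ℝ) + 1) := by positivity
      rw [hMdef]; linarith
    obtain ⟨m, ⟨t, ht, x, rfl⟩, hm⟩ := exists_lt_of_lt_csSup ⟨_, hS0⟩ hlt
    exact ⟨t, ht, x, hm⟩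
  choose tk htk xk hxk using hpts
  -- renormalisation to the hot spot `(−1, 0)`
  set vk : ℕ → ℝ → EuclideanSpace ℝ (Fin 3) → EuclideanSpace ℝ (Fin 3) := fun k =>
    nsRescale (Real.sqrt (-tk k)) (fun t x => v t (xk k + x)) with hvk_def
  have hck : ∀ k, 0 < Real.sqrt (-tk k) := fun k => Real.sqrt_pos.2 (neg_pos.2 (htk k))
  have hck2 : ∀ k, Real.sqrt (-tk k) ^ 2 = -tk k := fun k => Real.sq_sqrt (neg_pos.2 (htk k)).le
  have hvk : ∀ k, IsTypeIAncientMild C (vk k) := fun k =>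
    isTypeIAncientMild_nsRescale (isTypeIAncientMild_translate hv (xk k)) (hck k)
  have hvkpol : ∀ k, ∀ s < 0, ∀ y, ⟪curl (vk k s) y, EuclideanSpace.single 2 (1 : ℝ)⟫_ℝ = 0 := fun k =>
    poloidal_nsRescale (poloidal_translate hpol (xk k)) (hck k)
  -- the vertical size of `vk k` is that of `v` at the moved point
  have hQvk : ∀ k, ∀ t < 0, ∀ x, (-t) * (vk k t x 2) ^ 2 =
      Q (Real.sqrt (-tk k) ^ 2 * t) (xk k + Real.sqrt (-tk k) • x) := by
    intro k t ht x
    simp only [hvk_def, hQdef]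
    exact vertSize_nsRescale_translate _ _ _ _ _
  have hQvk_le : ∀ k, ∀ t < 0, ∀ x, (-t) * (vk k t x 2) ^ 2 ≤ M := by
    intro k t ht x
    rw [hQvk k t ht x]
    refine hQM _ ?_ _
    rw [hck2]
    exact mul_neg_of_pos_of_neg (neg_pos.2 (htk k)) ht
  have hQvk_one : ∀ k, (vk k (-1) 0 2) ^ 2 = Q (tk k) (xk k) := by
    intro k
    have h := hQvk k (-1) (by norm_num) 0
    rw [hck2, smul_zero, add_zero] at h
    have e : -tk k * (-1 : ℝ) = tk k := by ring
    rw [e] at h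
    simpa using h
  -- extraction of a limit
  obtain ⟨φ, hφ, W, hW, hpt, hgrad, -, -⟩ := exists_tendsto_of_isTypeIAncientMild_seq C hvk
  have hWpol : ∀ s < 0, ∀ y, ⟪curl (W s) y, EuclideanSpace.single 2 (1 : ℝ)⟫_ℝ = 0 := fun s hs y =>
    poloidal_of_tendsto (hgrad s hs y) fun j => hvkpol (φ j) s hs y
  -- convergence of the vertical components
  have hconv : ∀ t < 0, ∀ x, Tendsto (fun j => (vk (φ j) t x 2) ^ 2) atTop (𝓝 ((W t x 2) ^ 2)) := by
    intro t ht x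
    have h2 : Tendsto (fun j => vk (φ j) t x 2) atTop (𝓝 (W t x 2)) :=
      ((EuclideanSpace.proj (2 : Fin 3) : EuclideanSpace ℝ (Fin 3) →L[ℝ] ℝ).continuous.tendsto _).comp (hpt t ht x)
    exact h2.pow 2
  have hWle : ∀ t < 0, ∀ x, (-t) * (W t x 2) ^ 2 ≤ M := by
    intro t ht x
    have h := (hconv t ht x).const_mul (-t)
    exact le_of_tendsto' h fun j => hQvk_le (φ j) t ht x
  have hWone : (W (-1) 0 2) ^ 2 = M := by
    -- at the hot spot the values `Q (t_{φ j}) (x_{φ j}) ∈ (M − 1/(φ j + 1), M]` converge to `M`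
    have h1 := hconv (-1) (by norm_num) 0
    have hεj : Tendsto (fun j : ℕ => M - 1 / ((φ j : ℝ) + 1)) atTop (𝓝 M) := by
      have h0 : Tendsto (fun j : ℕ => 1 / ((φ j : ℝ) + 1)) atTop (𝓝 0) := by
        have ha : Tendsto (fun j : ℕ => (φ j : ℝ) + 1) atTop atTop := by
          refine tendsto_atTop_add_const_right _ 1 ?_
          exact tendsto_natCast_atTop_atTop.comp hφ.tendsto_atTop
        refine (tendsto_inv_atTop_zero.comp ha).congr fun j => ?_
        simp [one_div, Function.comp]
      simpa using (tendsto_const_nhds (x := M)).sub h0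
    have h2 : Tendsto (fun j => (vk (φ j) (-1) 0 2) ^ 2) atTop (𝓝 M) := by
      refine tendsto_of_tendsto_of_tendsto_of_le_of_le hεj tendsto_const_nhds (fun j => ?_) (fun j => ?_)
      · rw [hQvk_one]; exact (hxk (φ j)).le
      · rw [hQvk_one]; exact hQM _ (htk (φ j)) _
    exact tendsto_nhds_unique h1 h2
  -- conclusion
  have hW2ne : W (-1) 0 2 ≠ 0 := by
    intro h0
    rw [h0] at hWone
    have : M = 0 := by simpa using hWone.symm
    exact hMpos.ne' this
  refine ⟨W, hW.hasTypeITimeDecay, hW.continuousOn_uncurry, fun s t hst ht x => hW.mild_eq_heatExtension hst ht x,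
    fun t ht => hW.isDivFree ht, hWpol, hW2ne, fun t ht x => ?_⟩
  -- `√(−t)|W₂(t,x)| ≤ |W₂(−1,0)|` from `(−t) W₂(t,x)² ≤ M = W₂(−1,0)²`
  have hnn : 0 ≤ Real.sqrt (-t) * |W t x 2| := mul_nonneg (Real.sqrt_nonneg _) (abs_nonneg _)
  have hsq : (Real.sqrt (-t) * |W t x 2|) ^ 2 ≤ |W (-1) 0 2| ^ 2 := by
    rw [mul_pow, Real.sq_sqrt (neg_pos.2 ht).le, sq_abs, sq_abs, hWone]
    exact hWle t ht x
  exact (pow_le_pow_iff_left₀ hnn (abs_nonneg _) two_ne_zero).1 hsq
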